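import Summits.QuantumFields.BalabanUV.T4Continuum.Support.NE3EnergyShapes
import Summits.QuantumFields.BalabanUV.T4Continuum.Support.PeriodicChoice
import Literature.MathematicalPhysics.QuantumFieldTheory.Balaban1983to89.B7Prop6Flat
import HarnessLib

/-!
# T⁴ programme, node NE3 — P2's ROOT T-E FOR THE FLAT DATUM OVER THE GENUINE SMALL-FIELD CLASS `sfClass ε`
# (zero-action constrained minimisers are periodic pure gauges), and the JOINT NON-VACUITY of the two halves of NE3

NE3 formalisation swarm `b2b-balaban-t4-ne3-formalise-*`, LEAF PROVER 04 (unit `b2b-balaban-t4-ne3-formalise-leaf-04`,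
gen 3), support node «A-NV-joint» of the crew register `t4/formal/NE3/LEAVES.md` (typer ρ59) of the cell `pub-balaban`;
INTENT journal l.11416.  Answers the HONEST line of the owner's capstone `Support/NE3ShapeCrudeTorus` (p215418) and of
`Support/NE3EnergyShapes` (p212884): «each half's hypothesis set is separately witnessed (`actionRate_thm1Type_flat` over
`sfClass ε ∕ {flatCfg}`, `ne3EnergyRate_flat` over the SINGLETON class `flatClass ∕ {flatCfg}`); joint non-vacuity over ONE
class family is NOT shown» — the capstone's `hsub : sfClass ε j ⊆ 𝒞 j` excludes the singleton class, because every
periodic pure gauge of the flat configuration lies in every `sfClass ε j`.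

CONTENT (0 `def`, 0 `sorry`; kernel lane):
* §1 `eq_one_of_wt_eq_zero`: a unitary plaquette variable with vanishing Wilson weight `1 − Re tr W∕N = 0` IS `1`
  (`tr((W−1)ᴴ(W−1)) = 2N − 2 Re tr W`).
* §2 `hol_plaqWord_eq_one_of_levelAction_eq_zero`: a `U(N)`-valued `(N L^k)`-periodic configuration with level-`k` action `0`
  has ALL its plaquette variables equal to `1` (sum of non-negative weights + periodicity in the base point).
* §3 `gaugeAct_axialFn_eq_flatCfg` ∕ `exists_unitary_gauge_eq_gaugeAct_flatCfg`: zero curvature on `ℤ^d` ⇒ the complete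
  axial gauge (`B7Prop1Explicit.axialFn`, B7 p. 24) gauges the configuration to `1`: `U = 1^{g}` with `g` unitary
  (`B7Prop1Explicit.axial_bond_bound` at `α = 0`).
* §4 `avgIter_gaugeAct_flatCfg` ((11)∕(45) for the k-fold average BY NAME: `avgIter L (1^{g}) k = 1^{g ∘ (L^k•)}`),
  `apply_eq_apply_zero_of_gaugeAct_flatCfg_eq` (the constraint `1^{h} = 1` forces `h` constant on `ℤ^d`),
  `isPeriodicSite_of_gaugeAct_flatCfg` (periodicity of `1^{g}` + `g(P e_i) = g 0` ⇒ `g` periodic).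
* §5 `exists_periodic_gauge_of_isMinimiser_flatCfg`: in ANY class family of `U(N)`-valued `(N L^k)`-periodic
  configurations containing `1`, every run-`k` minimiser of the FLAT DATUM is `1^{g}` with `g` unitary AND
  `(N L^k)`-periodic (the cycle holonomies are killed by the constraint `avgIter L U k = 1`);
  **`ne3EnergyRate_flatCfg_of_class`** (T-E at the flat datum for every such class family) and its instance
  **`ne3EnergyRate_sfClass_flat`**: `NE3EnergyShapes.NE3EnergyRate d (sfClass d L N ε) L N b g C {flatCfg}` BY NAME for
  `L, N ≥ 1`, `ε ≥ 0`, every `b, g` and every `C ≥ 0` (gauge `u = (g_B ∘ (L•))·g_A⁻¹`, direction `Z = 0`, energy norm `0`)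
  — the flat case of the UNIQUENESS UP TO GAUGE of the constrained minimiser, `k` runs deep.
The JOINT instance of the capstone (`NE3ShapeCrudeTorus.ne3Shape_thm1Type_crude` on `𝒞 = sfClass 4 L N ε`, `dom = {flatCfg}`)
is filed separately on top of this module (it needs the capstone's import cone; this file deliberately imports only
`NE3EnergyShapes`, `PeriodicChoice` and B7's `B7Prop6Flat`).

HONEST FRAMING.  A NON-VACUITY result about the FLAT datum: it shows that P2's ROOT T-E is inhabited on the genuine
small-field class family that route (A) uses, so that the capstone's hypothesis set is jointly satisfiable over ONE class
family; it says NOTHING about Bałaban's minimisers at a non-flat datum.  NE3 is NOT proved; (H∃) and T-E remain HYPOTHESES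
at every non-flat datum; no estimate of the cell is touched; no conditional of the cell (`BetaPertH`, (B), (B^μ), G-an2-4)
is used or hidden; nothing printed is a hypothesis of a theorem; no `def`, no `sorry`, axioms ⊆ {propext, Classical.choice,
Quot.sound}.  Finite T⁴ rung (B)+1 — NOT infinite volume, NOT a mass gap, NOT the Clay problem, NOT summit progress.
PLACEMENT: `Summits/QuantumFields/BalabanUV/` (our statements).  HONEST DEPENDENCY (cell page 1): continuum YM on T⁴ ⇐
BetaPertH ∧ nine spine estimates (0/9 proved); BetaPertH ⇐ (D1) ∧ (D4) ∧ CAP+tail; G-an2-4 gates asym, D1 and NE2/3/4.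
-/

set_option autoImplicit false

open scoped BigOperators Matrix Matrix.Norms.L2Operator ComplexOrder
open NormedSpace Finset

namespace Summit.QuantumFields.BalabanUV.T4Continuum.NE3EnergyRateFlatClass

open Literature.MathematicalPhysics.QuantumFieldTheory.Balaban1983to89
open B7Prop1Explicit B7Prop2Explicit MatrixLog UnitaryModel
open T4AveragingDeficitWall hiding Site Plane Plaq Bond
open T4AveragingDeficitWallBoundary (IsPeriodicCfg periodBox mem_periodBox)
open T4AveragingDeficitNonAbelian (hol_add_period)
open B7Prop1Local (hol_plaqWord_eq)
open B7AvgGaugeCovariance (uLev uLev_apply)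
open B7Prop6Flat (avgIter_gaugeAct_units)
open AveragingDeficitPeriodicCounting (IsPeriodicDir isPeriodicDir_zero)
open AveragingDeficitTransport (mem_U1_of_unitary)
open MinimalActionLevels (levelAction levelAction_nonneg stepWt stepWt_pos perWin wt_nonneg_of_unitary)
open MinimalActionSandwich (IsMinimiser admissible)
open MinimalActionRate (sfClass)
open MinimalActionWitness (flatCfg avgIter_flatCfg flatCfg_mem_sfClass levelAction_flatCfg)
open NE3EnergyShapes (energyNorm energyNorm_zero residualScale residualScale_nonneg IsUnitarySite IsPeriodicSite
  NE3EnergyRate)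
open PeriodicChoice (apply_wrap_eq wrap_mem_periodBox)

noncomputable section

variable {d : ℕ} {n : Type*} [Fintype n] [DecidableEq n]

/-! ## §1 A unitary plaquette variable with vanishing Wilson weight is the identity -/

/-- For a unitary `W`: `tr((W − 1)ᴴ(W − 1)) = 2·(N − Re tr W)` — twice the un-normalised Wilson weight, as a complex
number with zero imaginary part. [folklore] -/
theorem trace_conjTranspose_mul_self_sub_one {W : Matrix n n ℂ} (hW : W ∈ unitary (Matrix n n ℂ)) :
    Matrix.trace ((W - 1)ᴴ * (W - 1))
      = ((2 * ((Fintype.card n : ℝ) - (Matrix.trace W).re) : ℝ) : ℂ) := by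
  have hWW : Wᴴ * W = 1 := by
    have h := Unitary.star_mul_self_of_mem hW
    rwa [Matrix.star_eq_conjTranspose] at h
  have hAA : (W - 1)ᴴ * (W - 1) = 1 + 1 - W - Wᴴ := by
    rw [Matrix.conjTranspose_sub, Matrix.conjTranspose_one, sub_mul, mul_sub, mul_sub, hWW, one_mul, mul_one, one_mul]
    abel
  rw [hAA, Matrix.trace_sub, Matrix.trace_sub, Matrix.trace_add, Matrix.trace_one, Matrix.trace_conjTranspose]
  apply Complex.ext
  · simp only [Complex.sub_re, Complex.add_re, Complex.natCast_re, Complex.star_def, Complex.conj_re, Complex.ofReal_re]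
    ring
  · simp only [Complex.sub_im, Complex.add_im, Complex.natCast_im, Complex.star_def, Complex.conj_im, Complex.ofReal_im]
    ring

/-- **A `U(N)` matrix with vanishing Wilson weight `1 − Re tr W ∕ N = 0` is the identity** (`‖W − 1‖²_{HS} = 2(N − Re tr W)`
and the Hilbert–Schmidt form is definite). [folklore] -/
theorem eq_one_of_wt_eq_zero [Nonempty n] {W : (Matrix n n ℂ)ˣ} (hW : W ∈ unitaryUnits (Matrix n n ℂ))
    (h : wt W = 0) : W = 1 := by
  have hU : (W : Matrix n n ℂ) ∈ unitary (Matrix n n ℂ) := mem_unitaryUnits.mp hW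
  have hn : (0 : ℝ) < Fintype.card n := by exact_mod_cast Fintype.card_pos
  have hre : (Matrix.trace (W : Matrix n n ℂ)).re = Fintype.card n := by
    unfold wt nReTr at h
    have h1 : (Matrix.trace (W : Matrix n n ℂ)).re / Fintype.card n = 1 := by linarith
    rwa [div_eq_one_iff_eq hn.ne'] at h1
  have htr : Matrix.trace (((W : Matrix n n ℂ) - 1)ᴴ * ((W : Matrix n n ℂ) - 1)) = 0 := by
    rw [trace_conjTranspose_mul_self_sub_one hU, hre, sub_self, mul_zero, Complex.ofReal_zero]
  have hA0 : (W : Matrix n n ℂ) - 1 = 0 := Matrix.trace_conjTranspose_mul_self_eq_zero_iff.mp htr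
  exact Units.ext (sub_eq_zero.mp hA0)

/-! ## §2 Zero action ⇒ zero curvature on the whole lattice (periodicity in the base point) -/

/-- A `U(N)`-valued configuration whose fine Wilson action over a window vanishes has trivial plaquette variables on
that window (the weights are non-negative). [folklore] -/
theorem fhol_eq_one_of_fineAction_eq_zero [Nonempty n] {U : Site d → Fin d → (Matrix n n ℂ)ˣ} (hU : IsUnitaryCfg U)
    {W : Finset (T4AveragingDeficitWall.Plaq d)} (h : fineAction U W = 0)
    {p : T4AveragingDeficitWall.Plaq d} (hp : p ∈ W) : fhol U p = 1 := by
  unfold fineAction at h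
  have h0 := (Finset.sum_eq_zero_iff_of_nonneg (fun q _ => wt_nonneg_of_unitary (hol_mem_of hU _ _))).mp h p hp
  exact eq_one_of_wt_eq_zero (hol_mem_of hU _ _) h0

/-- `A^{(k)}(U) = 0` for `L ≥ 1` forces the fine action over the period window to vanish. [folklore] -/
theorem fineAction_perWin_eq_zero_of_levelAction_eq_zero {L N k : ℕ} (hL : 1 ≤ L) {U : Site d → Fin d → (Matrix n n ℂ)ˣ}
    (h : levelAction d L N k U = 0) : fineAction U (perWin d (N * L ^ k)) = 0 := by
  unfold levelAction at h
  rcases mul_eq_zero.mp h with h1 | h1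
  · exact absurd h1 (pow_ne_zero _ (inv_ne_zero (stepWt_pos (d := d) L hL).ne'))
  · exact h1

/-- **ZERO LEVEL ACTION ⇒ ZERO CURVATURE ON `ℤ^d`**: a `U(N)`-valued `(N·L^k)`-periodic configuration (`L, N ≥ 1`) with
`A^{(k)}(U) = 0` has `U(∂p) = 1` for EVERY unit plaquette of `ℤ^d`, in both orientations (the period window carries one
representative of every plaquette up to a period shift). [folklore] -/
theorem hol_plaqWord_eq_one_of_levelAction_eq_zero [Nonempty n] {L N k : ℕ} (hL : 1 ≤ L) (hN : 1 ≤ N)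
    {U : Site d → Fin d → (Matrix n n ℂ)ˣ} (hU : IsUnitaryCfg U) (hP : IsPeriodicCfg U ((N * L ^ k : ℕ) : ℤ))
    (h : levelAction d L N k U = 0) (x : Site d) (κ μ : Fin d) (hκμ : κ ≠ μ) :
    hol U x (plaqWord κ μ) = 1 := by
  have hfa := fineAction_perWin_eq_zero_of_levelAction_eq_zero (N := N) (k := k) hL h
  have hPpos : 1 ≤ N * L ^ k := Nat.one_le_iff_ne_zero.mpr (Nat.mul_ne_zero (by omega) (pow_ne_zero _ (by omega)))
  -- ordered planes: the window statement
  have hlt : ∀ (y : Site d) (a b : Fin d), a < b → hol U y (plaqWord a b) = 1 := by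
    intro y a b hab
    -- move the base point into the period box
    have hper : ∀ (z : Site d) (i : Fin d),
        (fun z => hol U z (plaqWord a b)) (z + ((N * L ^ k : ℕ) : ℤ) • e i) = (fun z => hol U z (plaqWord a b)) z :=
      fun z i => hol_add_period hP i _ z
    have hwrap := apply_wrap_eq (g := fun z => hol U z (plaqWord a b)) (P := N * L ^ k) hper y
    rw [← hwrap]
    have hmem : ((fun i => y i % ((N * L ^ k : ℕ) : ℤ)), (⟨(a, b), hab⟩ : T4AveragingDeficitWall.Plane d))
        ∈ perWin d (N * L ^ k) :=
      Finset.mem_product.mpr ⟨wrap_mem_periodBox (N * L ^ k) hPpos y, Finset.mem_univ _⟩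
    exact fhol_eq_one_of_fineAction_eq_zero hU hfa hmem
  rcases lt_or_gt_of_ne hκμ with hlt' | hgt
  · exact hlt x κ μ hlt'
  · -- the reversed plaquette is the inverse holonomy
    have hswap : hol U x (plaqWord κ μ) = (hol U x (plaqWord μ κ))⁻¹ := by
      rw [hol_plaqWord_eq, hol_plaqWord_eq]; group
    rw [hswap, hlt x μ κ hgt, inv_one]

/-! ## §3 Zero curvature ⇒ pure gauge (the complete axial gauge of B7 p. 24 gauges a flat configuration to `1`) -/

/-- **ZERO CURVATURE ⇒ THE AXIAL GAUGE IS TRIVIAL**: if every unit plaquette variable of the `U(N)`-valued `U` is `1`, then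
`U^{v₀} = 1` for the complete axial gauge `v₀ = axialFn U y` based at any `y` (`B7Prop1Explicit.axial_bond_bound` at
`α = 0`). [folklore] -/
theorem gaugeAct_axialFn_eq_flatCfg [Nonempty n] {U : Site d → Fin d → (Matrix n n ℂ)ˣ} (hU : IsUnitaryCfg U)
    (hflat : ∀ (x : Site d) (κ μ : Fin d), κ ≠ μ → hol U x (plaqWord κ μ) = 1) (y : Site d) :
    gaugeAct (axialFn U y) U = flatCfg := by
  funext x μ
  have hU1 : ∀ z κ, U z κ ∈ U1 (Matrix n n ℂ) := fun z κ => mem_U1_of_unitary (hU z κ)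
  have h := axial_bond_bound U hU1 y (α := 0)
    (fun z κ ν hne => by rw [hflat z κ ν hne, Units.val_one, sub_self, norm_zero]) le_rfl x μ
  rw [mul_zero] at h
  have h1 : ((gaugeAct (axialFn U y) U x μ : (Matrix n n ℂ)ˣ) : Matrix n n ℂ) = 1 := by
    rw [← sub_eq_zero]; exact norm_le_zero_iff.mp h
  exact Units.ext h1

/-- Undoing a gauge transformation (group algebra of (8)). [folklore] -/
theorem gaugeAct_inv_gaugeAct' {G : Type*} [Group G] (u : Site d → G) (V : Site d → Fin d → G) :
    gaugeAct (fun z => (u z)⁻¹) (gaugeAct u V) = V := by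
  funext z μ
  simp only [gaugeAct, inv_inv]
  group

/-- **ZERO CURVATURE ⇒ PURE GAUGE ON `ℤ^d`**: `U = 1^{g}` with `g = v₀⁻¹` unitary. [folklore] -/
theorem exists_unitary_gauge_eq_gaugeAct_flatCfg [Nonempty n] {U : Site d → Fin d → (Matrix n n ℂ)ˣ} (hU : IsUnitaryCfg U)
    (hflat : ∀ (x : Site d) (κ μ : Fin d), κ ≠ μ → hol U x (plaqWord κ μ) = 1) :
    ∃ g : Site d → (Matrix n n ℂ)ˣ, (∀ x, g x ∈ unitaryUnits (Matrix n n ℂ)) ∧ U = gaugeAct g flatCfg := by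
  refine ⟨fun z => (axialFn U 0 z)⁻¹, fun z => (unitaryUnits (Matrix n n ℂ)).inv_mem (hol_mem_of hU _ _), ?_⟩
  conv_lhs => rw [← gaugeAct_inv_gaugeAct' (axialFn U 0) U]
  rw [gaugeAct_axialFn_eq_flatCfg hU hflat 0]

/-! ## §4 Averages of pure gauges; the constraint kills the cycle holonomies -/

/-- **(11)∕(45) for the `k`-fold average of a pure gauge of `1`**: `avgIter L (1^{g}) k = 1^{g ∘ (L^k •)}` — B7's gauge
covariance of (42)∕(43) for arbitrary gauge functions (`B7Prop6Flat.avgIter_gaugeAct_units`) and `avgIter L 1 k = 1`.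
[cite: Balaban1985Averaging, (11) p.19, (45) p.24] -/
theorem avgIter_gaugeAct_flatCfg (L : ℕ) (g : Site d → (Matrix n n ℂ)ˣ) (k : ℕ) :
    avgIter L (gaugeAct g (flatCfg : Site d → Fin d → (Matrix n n ℂ)ˣ)) k = gaugeAct (uLev L g k) flatCfg := by
  rw [avgIter_gaugeAct_units, avgIter_flatCfg]

/-- A function on `ℤ^d` invariant under every unit step is constant. [folklore] -/
theorem apply_eq_apply_zero_of_forall_add_e {β : Sort*} {f : Site d → β} (hf : ∀ (z : Site d) (μ : Fin d), f (z + e μ) = f z)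
    (z : Site d) : f z = f 0 := by
  have h := apply_wrap_eq (P := 1) (g := f) (fun x κ => by rw [Nat.cast_one, one_smul]; exact hf x κ) z
  have h0 : (fun κ => z κ % ((1 : ℕ) : ℤ)) = (0 : Site d) := by
    funext κ; simp
  rw [h0] at h
  exact h.symm

/-- **THE CONSTRAINT `1^{h} = 1` FORCES `h` CONSTANT** on `ℤ^d`. [folklore] -/
theorem apply_eq_apply_zero_of_gaugeAct_flatCfg_eq {G : Type*} [Group G] {h : Site d → G}
    (hh : gaugeAct h (fun (_ : Site d) (_ : Fin d) => (1 : G)) = fun _ _ => 1) (z : Site d) : h z = h 0 := by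
  refine apply_eq_apply_zero_of_forall_add_e (fun w μ => ?_) z
  have h1 := congrFun (congrFun hh w) μ
  simp only [gaugeAct, mul_one] at h1
  -- h1 : h w * (h (w + e μ))⁻¹ = 1
  rw [mul_inv_eq_one] at h1
  exact h1.symm

/-- **PERIODICITY OF THE GAUGE FROM PERIODICITY OF THE PURE GAUGE**: if `1^{g}` is `P`-periodic and `g(P e_i) = g(0)` for
every `i`, then `g` is `P`-periodic (the quotient `g(x)⁻¹ g(x + P e_i)` is step-invariant, hence constant, hence `1`).
[folklore] -/
theorem isPeriodicSite_of_gaugeAct_flatCfg {g : Site d → (Matrix n n ℂ)ˣ} {P : ℤ}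
    (hper : IsPeriodicCfg (gaugeAct g (flatCfg : Site d → Fin d → (Matrix n n ℂ)ˣ)) P) (h0 : ∀ i : Fin d, g (P • e i) = g 0) :
    IsPeriodicSite g P := by
  intro x i
  have hstep : ∀ (w : Site d) (μ : Fin d),
      (fun w => (g w)⁻¹ * g (w + P • e i)) (w + e μ) = (fun w => (g w)⁻¹ * g (w + P • e i)) w := by
    intro w μ
    have h1 := hper w i μ
    simp only [gaugeAct, flatCfg, mul_one] at h1
    -- h1 : g (w + P • e i) * (g (w + P • e i + e μ))⁻¹ = g w * (g (w + e μ))⁻¹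
    show (g (w + e μ))⁻¹ * g (w + e μ + P • e i) = (g w)⁻¹ * g (w + P • e i)
    rw [add_right_comm w (e μ) (P • e i)]
    calc (g (w + e μ))⁻¹ * g (w + P • e i + e μ)
        = (g w)⁻¹ * (g w * (g (w + e μ))⁻¹) * g (w + P • e i + e μ) := by group
      _ = (g w)⁻¹ * (g (w + P • e i) * (g (w + P • e i + e μ))⁻¹) * g (w + P • e i + e μ) := by rw [h1]
      _ = (g w)⁻¹ * g (w + P • e i) := by group
  have hc := apply_eq_apply_zero_of_forall_add_e (f := fun w => (g w)⁻¹ * g (w + P • e i)) hstep x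
  simp only [zero_add, h0, inv_mul_cancel] at hc
  -- hc : (g x)⁻¹ * g (x + P • e i) = 1
  exact (inv_mul_eq_one.mp hc).symm

/-! ## §5 Minimisers of the flat datum are periodic pure gauges; T-E for the flat datum over any class family of
periodic `U(N)` configurations containing `1` (in particular `sfClass ε`) -/

/-- **EVERY RUN-`k` MINIMISER OF THE FLAT DATUM IS A PERIODIC PURE GAUGE OF `1`** — in ANY class family `𝒞` of
`U(N)`-valued `(N·L^k)`-periodic configurations containing the flat one (`L, N ≥ 1`): `U = 1^{g}` with `g` unitary and
`(N·L^k)`-periodic.  Zero action (the flat configuration is admissible with action `0`, actions are `≥ 0`) ⇒ zero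
curvature ⇒ `U = 1^{g}`; the constraint `avgIter L U k = 1` reads `1^{g ∘ (L^k•)} = 1`, so `g ∘ (L^k•)` is constant and
the cycle holonomies `g(0)⁻¹g(N L^k e_i)` are trivial ⇒ `g` periodic. [folklore] -/
theorem exists_periodic_gauge_of_isMinimiser_flatCfg [Nonempty n] {𝒞 : ℕ → Set (Site d → Fin d → (Matrix n n ℂ)ˣ)}
    {L N : ℕ} (hL : 1 ≤ L) (hN : 1 ≤ N) {k : ℕ}
    (h𝒞 : ∀ U ∈ 𝒞 k, IsUnitaryCfg U ∧ IsPeriodicCfg U ((N * L ^ k : ℕ) : ℤ))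
    (h1 : (flatCfg : Site d → Fin d → (Matrix n n ℂ)ˣ) ∈ 𝒞 k)
    {U : Site d → Fin d → (Matrix n n ℂ)ˣ} (hU : IsMinimiser d 𝒞 L N k flatCfg U) :
    ∃ g : Site d → (Matrix n n ℂ)ˣ, (∀ x, g x ∈ unitaryUnits (Matrix n n ℂ)) ∧
      IsPeriodicSite g ((N * L ^ k : ℕ) : ℤ) ∧ U = gaugeAct g flatCfg := by
  obtain ⟨hUmem, havg⟩ := hU.mem
  obtain ⟨hunit, hperU⟩ := h𝒞 U hUmem
  -- zero action
  have hA0 : levelAction d L N k U = 0 :=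
    le_antisymm (by simpa only [levelAction_flatCfg] using hU.le flatCfg ⟨h1, avgIter_flatCfg L k⟩)
      (levelAction_nonneg L N k hL hunit)
  -- zero curvature, pure gauge
  have hflat := hol_plaqWord_eq_one_of_levelAction_eq_zero hL hN hunit hperU hA0
  obtain ⟨g, hgu, hUg⟩ := exists_unitary_gauge_eq_gaugeAct_flatCfg hunit hflat
  refine ⟨g, hgu, ?_, hUg⟩
  -- the constraint: `g ∘ (L^k •)` is constant
  have hcon : gaugeAct (uLev L g k) (flatCfg : Site d → Fin d → (Matrix n n ℂ)ˣ) = flatCfg := by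
    rw [← avgIter_gaugeAct_flatCfg, ← hUg, havg]
  have hconst : ∀ z : Site d, uLev L g k z = uLev L g k 0 :=
    apply_eq_apply_zero_of_gaugeAct_flatCfg_eq (G := (Matrix n n ℂ)ˣ) hcon
  -- periodicity of `g`
  refine isPeriodicSite_of_gaugeAct_flatCfg (hUg ▸ hperU) fun i => ?_
  have h2 := hconst ((N : ℤ) • e i)
  simp only [uLev_apply, smul_zero, smul_smul] at h2
  have hcast : ((N * L ^ k : ℕ) : ℤ) = (L : ℤ) ^ k * (N : ℤ) := by push_cast; ring
  rw [hcast]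
  exact h2

/-- **P2's ROOT T-E FOR THE FLAT DATUM OVER ANY CLASS FAMILY OF PERIODIC `U(N)` CONFIGURATIONS CONTAINING `1`**
(`NE3EnergyShapes.NE3EnergyRate` BY NAME): for `L, N ≥ 1`, all `b, g`, every `C ≥ 0`, if every `𝒞 k` consists of
`U(N)`-valued `(N·L^k)`-periodic configurations and contains the flat one, then `NE3EnergyRate d 𝒞 L N b g C {flatCfg}`.
For the run-A minimiser `U_A = 1^{g_A}` (level `k`) and the run-B minimiser `U_B = 1^{g_B}` (level `k+1`),
`W := rescale L (bavg L U_B) = 1^{g_B ∘ (L•)}` ((45) BY NAME), and the periodic unitary gauge `u := (g_B ∘ (L•))·g_A⁻¹`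
gives `U_A^u = W = W·e^0` EXACTLY: direction `Z = 0`, energy norm `0 ≤ C·residualScale`.  Covers B11's classes (2)∕(6)∕(7)
read on the torus and the singleton `flatClass`; the flat case of the uniqueness-up-to-gauge of the constrained minimiser.
NE3 is NOT proved by it. [folklore] -/
theorem ne3EnergyRate_flatCfg_of_class [Nonempty n] {𝒞 : ℕ → Set (Site d → Fin d → (Matrix n n ℂ)ˣ)} {L N : ℕ}
    (hL : 1 ≤ L) (hN : 1 ≤ N)
    (h𝒞 : ∀ k, ∀ U ∈ 𝒞 k, IsUnitaryCfg U ∧ IsPeriodicCfg U ((N * L ^ k : ℕ) : ℤ))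
    (h1 : ∀ k, (flatCfg : Site d → Fin d → (Matrix n n ℂ)ˣ) ∈ 𝒞 k) (b g : ℝ) {C : ℝ} (hC : 0 ≤ C) :
    NE3EnergyRate d 𝒞 L N b g C {flatCfg} := by
  intro k _ V hV UA UB hA hB _
  rw [Set.mem_singleton_iff] at hV
  subst hV
  obtain ⟨gA, hgAu, hgAp, hUA⟩ := exists_periodic_gauge_of_isMinimiser_flatCfg hL hN (h𝒞 k) (h1 k) hA
  obtain ⟨gB, hgBu, hgBp, hUB⟩ := exists_periodic_gauge_of_isMinimiser_flatCfg hL hN (h𝒞 (k + 1)) (h1 (k + 1)) hB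
  -- the averaged run-B minimiser read on run A's lattice is the pure gauge `1^{g_B ∘ (L•)}`
  have hW : rescale L (bavg L UB) = gaugeAct (uLev L gB 1) flatCfg := by
    have h := avgIter_gaugeAct_flatCfg L gB 1
    rw [← hUB] at h
    exact h
  refine ⟨fun x => uLev L gB 1 x * (gA x)⁻¹, fun (_ : Site d) (_ : Fin d) => (0 : Matrix n n ℂ),
    fun x => (unitaryUnits (Matrix n n ℂ)).mul_mem (hgBu _) ((unitaryUnits (Matrix n n ℂ)).inv_mem (hgAu x)),
    fun x i => ?_, fun _ _ => (skewAdjoint (Matrix n n ℂ)).zero_mem, isPeriodicDir_zero _, ?_, ?_⟩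
  · -- periodicity of the gauge `u`
    simp only [uLev_apply, pow_one]
    rw [hgAp x i, smul_add, smul_smul]
    have hcast : (L : ℤ) * ((N * L ^ k : ℕ) : ℤ) = ((N * L ^ (k + 1) : ℕ) : ℤ) := by push_cast; ring
    rw [hcast, hgBp]
  · -- `U_A^u = W · e^0`
    rw [vary_zero_dir, hW, hUA]
    funext x μ
    simp only [gaugeAct, flatCfg, mul_one]
    group
  · rw [energyNorm_zero]
    exact mul_nonneg hC (residualScale_nonneg d L N b g k)

/-- **P2's ROOT T-E FOR THE FLAT DATUM OVER THE GENUINE SMALL-FIELD CLASS `sfClass ε`** — the class family of route (A)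
(`MinimalActionRate.sfClass`: `U(N)`-valued, `(N·L^k)`-periodic, `|U(∂p) − 1| ≤ ε∕(L^k)²`; contains `1` for `ε ≥ 0`):
`NE3EnergyRate d (sfClass d L N ε) L N b g C {flatCfg}` for `L, N ≥ 1`, `ε ≥ 0`, all `b, g`, every `C ≥ 0`.  Together
with the owner's `MinimalActionThm1Type.actionRate_thm1Type_flat` (same `𝒞`, same `dom`) this makes the two halves of
NE3 JOINTLY inhabited over ONE class family; NE3 is NOT proved by it. [folklore] -/
theorem ne3EnergyRate_sfClass_flat [Nonempty n] {L N : ℕ} (hL : 1 ≤ L) (hN : 1 ≤ N) {ε : ℝ} (hε : 0 ≤ ε) (b g : ℝ)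
    {C : ℝ} (hC : 0 ≤ C) :
    NE3EnergyRate d (sfClass (n := n) d L N ε) L N b g C {flatCfg} :=
  ne3EnergyRate_flatCfg_of_class hL hN (fun _ _ hU => ⟨hU.1, hU.2.1⟩) (fun k => flatCfg_mem_sfClass L N hε k) b g hC

end

end Summit.QuantumFields.BalabanUV.T4Continuum.NE3EnergyRateFlatClass
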